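import Summits.CriticalPhenomena.PercolationContinuityZ3.Theorems.PercNearOneGluingNoHeavyLowerTailSahiMomentExpansion
import Mathlib.Tactic.Linarith
import Mathlib.Tactic.Ring
import HarnessLib

/-!
# `NoHeavyLowerTail` (stmt-CriticalPhenomena-4575) — the DEFECT EXPANSION of Sahi's `E_n` in one slot, and positivity at ALL orders from it

Support file, seat `prim-l12-p5` (gen 4), `--supports stmt-CriticalPhenomena-4575`.  No definitions, no named facts, no sorries.
Continues `…SahiMomentExpansion` (block expansion in the head slot; notation `E(g|S) = sahiE μ S.card (fun j => g (S.orderEmbOfFin rfl j))`),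
`…SahiMeetTowerAllOrders` (hierarchy identity, `C_m` on meet towers), `…SahiE3MeetContainment` (C′), `…SahiE4MeetTower` (fourth-order bound).

**DEFECT EXPANSION** (`sahiE_cons_eq_defect_expansion`; ANY weight `μ`, ANY functions `d, g_0,…,g_m` — pure multilinear algebra):

  `E_{m+2}(d, g) = (m + 1 − E d)·E_{m+1}(g) + Σ_{∅ ≠ T ⊊ univ} |T|!·E[(1−d)·∏_{i∈T} g_i]·E_{|Tᶜ|}(g|Tᶜ) − (m+1)!·E[(1−d)·∏_i g_i]`.

For indicators `g_i = 1_{A_i}`, `d = 1_D` the moments are the MEET DEFECTS `μ(⋂_{i∈T} A_i ∖ D)`: a slot enters `E_n` only through the defects of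
the meets it fails to absorb, with factorial weights and the lower-order `E` of the complementary sub-family (convention `E₀ := −1` for the top
block).  Special cases: `D ⊇` all pairwise meets ⇒ the hierarchy identity (`SahiMeetTowerAll.sahiE_cons_eq_of_pairwise`); `m + 1 = 2` ⇒ the meet
form of `E₃` (`SahiMeetContainment.sahiE3_eq_meet_form`); `m + 1 = 3` ⇒ `SahiMeetTower.sahiE_four_meet_defect_form`; `d = 0` ⇒ the moment
recursion.  Proof: linearity in the head slot (`d = 1 − (1−d)`), unnormalised branching, and the moment expansion at `x = 1 − d`.

**CONSEQUENCES (all orders; no monotonicity, no correlation inequality — only the SIGNS of the defects and of the lower-order functionals).**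
Nonnegative weight, `g_i ≥ 0`, `d ≤ 1`:
* `sahiE_cons_ge_defect` — if every sub-family `g|S`, `1 ≤ |S| ≤ m`, has `E ≥ 0`:
  `E_{m+2}(d,g) ≥ (m + 1 − E d)·E_{m+1}(g) − (m+1)!·E[(1−d)∏ g]`;
* `sahiE_cons_ge_defect_sharp` — with `g_i ≤ 1`, `m ≥ 1`, sub-families of sizes `2..m` nonnegative:
  `E_{m+2}(d,g) ≥ (m + 1 − E d)·E_{m+1}(g) − m!·(m + 1 − Σ_i E g_i)·E[(1−d)∏ g]` — for `m + 1 = 2, 3` exactly the certificates C′ and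
  `sahiE_four_ge_meet_defect` landed earlier, now for every order: `C_{m+2}(d, g)` follows from hereditary `C(g)` whenever the top meet defect
  `E[(1−d)∏ g] = μ(⋂A_i ∖ D)` is at most `(m + 1 − E d)·E_{m+1}(g) / (m!·(m + 1 − Σ E g_i))`;
* **"Theorem E"** `sahiE_cons_ge_of_absorbs_top` / `sahiE_cons_nonneg_of_absorbs_top` — if `d` absorbs the TOTAL product (`(1−d)·∏ g = 0`,
  events: `D ⊇ ⋂_i A_i`) and `g` is hereditarily Sahi-nonnegative, then `E_{m+2}(d, g) ≥ (m + 1 − E d)·E_{m+1}(g) ≥ 0` (probability weight).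
* FKG consequences are in `…SahiHereditaryMeetAbsorption`: a meet tower capped by ANY slot containing its total meet, and Sahi's `C_n` for
  all `n` on the HEREDITARILY MEET-ABSORBING families (every sub-family of size `≥ 3` has a member containing the meet of the others) — a
  hereditary class strictly larger than the meet towers of `…SahiMeetTowerAllOrders`.
Hand versions and exact checks: lane report `P5-REPORT.md` §3i(n),(n′),(q) (gen 3) and §3j (gen 4).
-/

namespace Summit.CriticalPhenomena.PercolationContinuityZ3.Theorems

namespace SahiDefectExpansion

open Finset Function Literature.Combinatorics.Sahi2008 SahiMomentExpansion
open scoped Nat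

variable {α : Type*} [Fintype α]

/-! ### The defect expansion -/

/-- `E[1 − d] = E[1] − E[d]`. [folklore] -/
theorem ex_one_sub (μ : α → ℝ) (d : α → ℝ) : ex μ (1 - d) = ex μ 1 - ex μ d := by
  unfold ex
  rw [← Finset.sum_sub_distrib]
  exact Finset.sum_congr rfl fun a _ => by simp only [Pi.sub_apply, Pi.one_apply]; ring

/-- **Defect expansion of `E_{m+2}` in the head slot** (any weight `μ`, any functions): for `d` and `g_0,…,g_m`,
`E_{m+2}(d, g) = (m + 1 − E d)·E_{m+1}(g) + Σ_{∅ ≠ T ⊊ univ} |T|!·E[(1−d)·∏_{i∈T} g_i]·E_{|Tᶜ|}(g|Tᶜ) − (m+1)!·E[(1−d)·∏_i g_i]`.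
For indicators `g_i = 1_{A_i}`, `d = 1_D` the moments are the MEET DEFECTS `μ(⋂_{i∈T} A_i ∖ D)`: the slot `D` enters `E_{m+2}` only through the
defects of the meets it fails to absorb, with factorial weights and the lower-order `E` of the complementary sub-family (convention `E₀ := −1`
for the top block).  `D ⊇` all pairwise meets: the hierarchy identity of `…SahiMeetTowerAllOrders`; `m + 1 = 2`: the meet form of `E₃`
(`…SahiE3MeetContainment`); `m + 1 = 3`: `…SahiE4MeetTower`. [this file] -/
theorem sahiE_cons_eq_defect_expansion (μ : α → ℝ) (m : ℕ) (d : α → ℝ) (g : Fin (m + 1) → α → ℝ) :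
    sahiE μ (m + 2) (Fin.cons d g : Fin (m + 2) → α → ℝ)
      = (((m : ℝ) + 1) - ex μ d) * sahiE μ (m + 1) g
        + ∑ T : Finset (Fin (m + 1)) with (T.Nonempty ∧ T ≠ univ),
            ((T.card)! : ℝ) * (ex μ ((1 - d) * ∏ i ∈ T, g i)
              * sahiE μ Tᶜ.card (fun j => g (Tᶜ.orderEmbOfFin rfl j)))
        - ((m + 1)! : ℝ) * ex μ ((1 - d) * ∏ i, g i) := by
  have hsplit : (Fin.cons d g : Fin (m + 2) → α → ℝ)
      = update (Fin.cons (1 : α → ℝ) g : Fin (m + 2) → α → ℝ) 0 ((1 : α → ℝ) + (-1 : ℝ) • (1 - d)) := by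
    rw [Fin.update_cons_zero]
    congr 1
    funext a
    simp only [Pi.add_apply, Pi.smul_apply, Pi.sub_apply, Pi.one_apply, smul_eq_mul]
    ring
  rw [hsplit, sahiE_update_add, sahiE_update_smul, Fin.update_cons_zero, Fin.update_cons_zero,
    sahiE_one_cons_eq, sahiE_cons_eq_moment_expansion μ m (1 - d) g, ex_one_sub]
  ring

/-! ### Consequences: the all-order defect certificate and hereditary positivity with an absorbing slot -/

/-- Defect moments are nonnegative: `μ ≥ 0`, `g_i ≥ 0`, `d ≤ 1` ⇒ `0 ≤ E[(1−d)·∏_{i∈T} g_i]`. [folklore] -/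
theorem ex_defect_nonneg {μ : α → ℝ} (hμ : ∀ a, 0 ≤ μ a) {N : ℕ} {g : Fin N → α → ℝ} (hg : ∀ i a, 0 ≤ g i a)
    {d : α → ℝ} (hd : ∀ a, d a ≤ 1) (T : Finset (Fin N)) : 0 ≤ ex μ ((1 - d) * ∏ i ∈ T, g i) :=
  ex_nonneg hμ fun a => by
    simp only [Pi.mul_apply, Pi.sub_apply, Pi.one_apply, Finset.prod_apply]
    exact mul_nonneg (sub_nonneg.mpr (hd a)) (Finset.prod_nonneg fun i _ => hg i a)

/-- **All-order defect certificate.**  Nonnegative weight, `g_i ≥ 0`, `d ≤ 1`; if every sub-family `g|S` with `1 ≤ |S| ≤ m` has `E ≥ 0`, then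
`E_{m+2}(d, g) ≥ (m + 1 − E d)·E_{m+1}(g) − (m+1)!·E[(1−d)·∏_i g_i]`: `C_{m+2}` for `(d, g)` follows from `C_{m+1}(g)` as soon as the
top meet defect is small (the case `m + 1 = 2` is the certificate C′ of `…SahiE3MeetContainment`, `m + 1 = 3` the bound of `…SahiE4MeetTower`,
both in their crude form). [this file] -/
theorem sahiE_cons_ge_defect {μ : α → ℝ} (hμ : ∀ a, 0 ≤ μ a) (m : ℕ) (d : α → ℝ) (g : Fin (m + 1) → α → ℝ)
    (hg : ∀ i a, 0 ≤ g i a) (hd : ∀ a, d a ≤ 1)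
    (hsub : ∀ T : Finset (Fin (m + 1)), T.Nonempty → T ≠ univ →
      0 ≤ sahiE μ Tᶜ.card (fun j => g (Tᶜ.orderEmbOfFin rfl j))) :
    (((m : ℝ) + 1) - ex μ d) * sahiE μ (m + 1) g - ((m + 1)! : ℝ) * ex μ ((1 - d) * ∏ i, g i)
      ≤ sahiE μ (m + 2) (Fin.cons d g : Fin (m + 2) → α → ℝ) := by
  rw [sahiE_cons_eq_defect_expansion]
  have hS : 0 ≤ ∑ T : Finset (Fin (m + 1)) with (T.Nonempty ∧ T ≠ univ),
      ((T.card)! : ℝ) * (ex μ ((1 - d) * ∏ i ∈ T, g i)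
        * sahiE μ Tᶜ.card (fun j => g (Tᶜ.orderEmbOfFin rfl j))) := by
    refine Finset.sum_nonneg fun T hT => ?_
    have hT' := (Finset.mem_filter.mp hT).2
    exact mul_nonneg (Nat.cast_nonneg _) (mul_nonneg (ex_defect_nonneg hμ hg hd T) (hsub T hT'.1 hT'.2))
  linarith

/-- **Hereditary positivity plus an absorbing slot, lower bound** ("Theorem E"): nonnegative weight, `g_i ≥ 0`, `d ≤ 1` with
`(1 − d)·∏_i g_i = 0` (for indicators: `D ⊇ ⋂_i A_i`, the TOTAL meet only), and `E ≥ 0` for every sub-family `g|S`, `1 ≤ |S| ≤ m`: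
then `E_{m+2}(d, g) ≥ (m + 1 − E d)·E_{m+1}(g)`. [this file] -/
theorem sahiE_cons_ge_of_absorbs_top {μ : α → ℝ} (hμ : ∀ a, 0 ≤ μ a) (m : ℕ) (d : α → ℝ) (g : Fin (m + 1) → α → ℝ)
    (hg : ∀ i a, 0 ≤ g i a) (hd : ∀ a, d a ≤ 1) (htop : ∀ a, (1 - d a) * ∏ i, g i a = 0)
    (hsub : ∀ T : Finset (Fin (m + 1)), T.Nonempty → T ≠ univ →
      0 ≤ sahiE μ Tᶜ.card (fun j => g (Tᶜ.orderEmbOfFin rfl j))) :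
    (((m : ℝ) + 1) - ex μ d) * sahiE μ (m + 1) g ≤ sahiE μ (m + 2) (Fin.cons d g : Fin (m + 2) → α → ℝ) := by
  have htop' : ex μ ((1 - d) * ∏ i, g i) = 0 := by
    unfold ex
    refine Finset.sum_eq_zero fun a _ => ?_
    simp only [Pi.mul_apply, Pi.sub_apply, Pi.one_apply, Finset.prod_apply, htop a, mul_zero]
  have key := sahiE_cons_ge_defect hμ m d g hg hd hsub
  rw [htop', mul_zero, sub_zero] at key
  exact key

/-- **Hereditary positivity plus an absorbing slot ⇒ `E_{m+2} ≥ 0`** ("Theorem E"): probability weight `μ ≥ 0`, `g_i ≥ 0`, `d ≤ 1`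
absorbing the total product (`(1−d)·∏ g = 0`), and `E ≥ 0` for `g` and all its sub-families: then `E_{m+2}(d, g) ≥ 0`.  No monotonicity
and no correlation inequality is used — positivity enters only through the signs of the defects and of the lower-order functionals.
(`m + 1 = 2`: `E₃(D, A, B) ≥ 0` for `D ⊇ A ∩ B` from `Cov(A,B) ≥ 0`, Theorem C; towers: Theorem D.) [this file] -/
theorem sahiE_cons_nonneg_of_absorbs_top {μ : α → ℝ} (hμ0 : ∀ a, 0 ≤ μ a) (hμ1 : ∑ a, μ a = 1) (m : ℕ)
    (d : α → ℝ) (g : Fin (m + 1) → α → ℝ) (hg : ∀ i a, 0 ≤ g i a) (hd : ∀ a, d a ≤ 1)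
    (htop : ∀ a, (1 - d a) * ∏ i, g i a = 0)
    (hsub : ∀ T : Finset (Fin (m + 1)), T ≠ univ → 0 ≤ sahiE μ Tᶜ.card (fun j => g (Tᶜ.orderEmbOfFin rfl j))) :
    0 ≤ sahiE μ (m + 2) (Fin.cons d g : Fin (m + 2) → α → ℝ) := by
  have hE : 0 ≤ sahiE μ (m + 1) g := by
    have h := hsub ∅ (fun h => Finset.univ_nonempty.ne_empty h.symm)
    rwa [subfamily_congr μ Finset.compl_empty g, subfamily_univ] at h
  have hEd : ex μ d ≤ 1 := by
    have := ex_mono (μ := μ) hμ0 hd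
    rwa [ex_const hμ1] at this
  have key := sahiE_cons_ge_of_absorbs_top hμ0 m d g hg hd htop (fun T _ hT => hsub T hT)
  have hm : (0 : ℝ) ≤ m := Nat.cast_nonneg m
  have : 0 ≤ (((m : ℝ) + 1) - ex μ d) * sahiE μ (m + 1) g := mul_nonneg (by linarith) hE
  linarith

/-- **All-order defect certificate, sharp form** (the exact generalisation of C′ of `…SahiE3MeetContainment` (`m + 1 = 2`) and of
`sahiE_four_ge_meet_defect` of `…SahiE4MeetTower` (`m + 1 = 3`)).  Nonnegative weight, `0 ≤ g_i ≤ 1`, `d ≤ 1`, `m ≥ 1`; if every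
sub-family `g|S` with `2 ≤ |S| ≤ m` has `E ≥ 0`, then
`E_{m+2}(d, g) ≥ (m + 1 − E d)·E_{m+1}(g) − m!·(m + 1 − Σ_i E g_i)·E[(1−d)·∏_i g_i]`
(the blocks `T = {i}ᶜ` contribute `m!·E[(1−d)∏_{k≠i} g_k]·E g_i ≥ m!·E[(1−d)∏_k g_k]·E g_i`). [this file] -/
theorem sahiE_cons_ge_defect_sharp {μ : α → ℝ} (hμ : ∀ a, 0 ≤ μ a) (m : ℕ) (hm : 1 ≤ m) (d : α → ℝ)
    (g : Fin (m + 1) → α → ℝ) (hg0 : ∀ i a, 0 ≤ g i a) (hg1 : ∀ i a, g i a ≤ 1) (hd : ∀ a, d a ≤ 1)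
    (hsub : ∀ T : Finset (Fin (m + 1)), T.Nonempty → 2 ≤ Tᶜ.card →
      0 ≤ sahiE μ Tᶜ.card (fun j => g (Tᶜ.orderEmbOfFin rfl j))) :
    (((m : ℝ) + 1) - ex μ d) * sahiE μ (m + 1) g
        - (m ! : ℝ) * (((m : ℝ) + 1) - ∑ i, ex μ (g i)) * ex μ ((1 - d) * ∏ i, g i)
      ≤ sahiE μ (m + 2) (Fin.cons d g : Fin (m + 2) → α → ℝ) := by
  rw [sahiE_cons_eq_defect_expansion]
  set F : Finset (Fin (m + 1)) → ℝ := fun T =>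
    ((T.card)! : ℝ) * (ex μ ((1 - d) * ∏ i ∈ T, g i) * sahiE μ Tᶜ.card (fun j => g (Tᶜ.orderEmbOfFin rfl j))) with hF
  -- the co-singleton blocks `{i}ᶜ`
  have hne : ∀ i : Fin (m + 1), (({i} : Finset (Fin (m + 1)))ᶜ).Nonempty := by
    intro i
    rw [← Finset.card_pos, card_compl, Fintype.card_fin, card_singleton]
    omega
  have hval : ∀ i : Fin (m + 1),
      F ({i}ᶜ) = (m ! : ℝ) * (ex μ ((1 - d) * ∏ k ∈ ({i} : Finset (Fin (m + 1)))ᶜ, g k) * ex μ (g i)) := by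
    intro i
    simp only [hF]
    rw [card_compl, Fintype.card_fin, card_singleton, Nat.add_sub_cancel, subfamily_congr μ (compl_compl _) g]
    congr 2
    have hc : 1 = ({i} : Finset (Fin (m + 1))).card := (card_singleton i).symm
    rw [← sahiE_cast μ hc, sahiE_one_apply]
    congr 1
    have e1 : ({i} : Finset (Fin (m + 1))).orderEmbOfFin rfl (Fin.cast hc 0)
        = ({i} : Finset (Fin (m + 1))).orderEmbOfFin (card_singleton i) 0 :=
      Finset.orderEmbOfFin_eq_orderEmbOfFin_iff.mpr rfl
    rw [e1, Finset.orderEmbOfFin_singleton]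
  -- they are among the blocks, and the other blocks contribute nonnegatively
  have h1 : ∑ i : Fin (m + 1), F ({i}ᶜ) ≤ ∑ T : Finset (Fin (m + 1)) with (T.Nonempty ∧ T ≠ univ), F T := by
    rw [← Finset.sum_image (f := F) (s := (univ : Finset (Fin (m + 1))))
      (fun i _ j _ (h : ({i} : Finset (Fin (m + 1)))ᶜ = {j}ᶜ) => by
        have := compl_injective h
        rwa [Finset.singleton_inj] at this)]
    apply Finset.sum_le_sum_of_subset_of_nonneg
    · intro T hT
      obtain ⟨i, _, rfl⟩ := Finset.mem_image.mp hT
      rw [Finset.mem_filter]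
      refine ⟨mem_univ _, hne i, fun h => ?_⟩
      have : i ∈ (({i} : Finset (Fin (m + 1)))ᶜ) := by rw [h]; exact mem_univ _
      rw [mem_compl] at this
      exact this (mem_singleton_self i)
    · intro T hT hTi
      have hT' := (Finset.mem_filter.mp hT).2
      have hcpos : 0 < Tᶜ.card := by
        rw [Finset.card_pos]
        by_contra h
        rw [Finset.not_nonempty_iff_eq_empty, Finset.compl_eq_empty_iff] at h
        exact hT'.2 h
      have hc1 : Tᶜ.card ≠ 1 := by
        intro h
        obtain ⟨i, hi⟩ := Finset.card_eq_one.mp h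
        apply hTi
        rw [Finset.mem_image]
        refine ⟨i, mem_univ _, ?_⟩
        rw [← hi, compl_compl]
      have h2 : 2 ≤ Tᶜ.card := by omega
      exact mul_nonneg (Nat.cast_nonneg _) (mul_nonneg (ex_defect_nonneg hμ hg0 hd T) (hsub T hT'.1 h2))
  -- each co-singleton block dominates `m!·E[(1−d)∏ g]·E g_i`
  have h3 : ∀ i : Fin (m + 1),
      (m ! : ℝ) * (ex μ ((1 - d) * ∏ k, g k) * ex μ (g i)) ≤ F ({i}ᶜ) := by
    intro i
    rw [hval i]
    refine mul_le_mul_of_nonneg_left (mul_le_mul_of_nonneg_right (ex_mono hμ fun a => ?_)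
      (ex_nonneg hμ (hg0 i))) (Nat.cast_nonneg _)
    simp only [Pi.mul_apply, Pi.sub_apply, Pi.one_apply, Finset.prod_apply]
    rw [← Finset.mul_prod_erase univ (fun k => g k a) (mem_univ i), ← Finset.compl_singleton]
    have hP : 0 ≤ ∏ k ∈ ({i} : Finset (Fin (m + 1)))ᶜ, g k a := Finset.prod_nonneg fun k _ => hg0 k a
    have h1d : 0 ≤ 1 - d a := sub_nonneg.mpr (hd a)
    nlinarith [mul_le_of_le_one_left hP (hg1 i a), mul_nonneg h1d hP]
  have h4 : (m ! : ℝ) * (ex μ ((1 - d) * ∏ k, g k) * ∑ i, ex μ (g i))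
      ≤ ∑ T : Finset (Fin (m + 1)) with (T.Nonempty ∧ T ≠ univ), F T := by
    rw [Finset.mul_sum, Finset.mul_sum]
    exact (Finset.sum_le_sum fun i _ => h3 i).trans h1
  have hfac : ((m + 1)! : ℝ) = ((m : ℝ) + 1) * (m ! : ℝ) := by
    push_cast [Nat.factorial_succ]
    ring
  rw [hfac]
  linarith [h4]

end SahiDefectExpansion

end Summit.CriticalPhenomena.PercolationContinuityZ3.Theorems
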